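import Summits.Ventures.PercRepro.S2PaymentSixteenSeven

/-!
# PercRepro — S2: NULLITY DESCENT, AND THE PAYMENT CLOSURE OF `(16, 7)` WITH `ν(W) ≥ k` (p7, gen 10; sub-claim S2; the `p = 16` row)

A set `W` with `ν(W) ≥ k` contains a subset `W'` with `ν(W') = k` exactly: while `ν(W) > k` the set is dependent, and deleting
an element `x` of a circuit `C ⊆ W` keeps the rank (`x ∈ cl(C ∖ x) ⊆ cl(W ∖ x)`) and drops the size by one, so `ν(W ∖ x) = ν(W) − 1 ≥ k`
(**`S2.exists_subset_encard_eq_eRk_add`**, strong induction on `|W|`). Hence S2PaymentSixteenSeven's concentrated hypothesis may be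
read with `≥`: **`ThmN.c025_sixteen_seven_of_concentrated'`** — the cell `(16, 7)` closes on every `e`-free coloop-free core of rank
`16` on `23` points carrying a set `W` with `(|W| ≤ 18 ∧ ν(W) ≥ 6) ∨ (|W| ≤ 14 ∧ ν(W) ≥ 5) ∨ (|W| ≤ 9 ∧ ν(W) ≥ 4)`. Axioms: standard.
-/

open scoped Matroid

namespace PercRepro

namespace S2

open Set

variable {α : Type}

/-- **Nullity descent**: if `ρ(W) + k ≤ |W|` (`ν(W) ≥ k`) then some `W' ⊆ W` has `|W'| = ρ(W') + k` (`ν(W') = k`). -/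
theorem exists_subset_encard_eq_eRk_add (M : Matroid α) [M.Finite] {W : Set α} (hW : W ⊆ M.E) (k : ℕ)
    (hk : M.eRk W + k ≤ W.encard) : ∃ W' ⊆ W, W'.encard = M.eRk W' + k := by
  classical
  suffices h : ∀ n : ℕ, ∀ W : Set α, W ⊆ M.E → W.ncard = n → M.eRk W + k ≤ W.encard →
      ∃ W' ⊆ W, W'.encard = M.eRk W' + k from h _ W hW rfl hk
  intro n
  refine Nat.strong_induction_on n fun n ih => ?_
  intro W hW hn hk
  have hWfin : W.Finite := M.ground_finite.subset hW
  by_cases heq : W.encard = M.eRk W + k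
  · exact ⟨W, subset_rfl, heq⟩
  have hlt : M.eRk W + k < W.encard := lt_of_le_of_ne hk (Ne.symm heq)
  -- `W` is dependent: an independent `W` has `ρ(W) = |W|`, impossible under `ρ(W) + k < |W|`
  have hdep : M.Dep W := by
    by_contra hnd
    have hind : M.Indep W := by
      by_contra hni
      exact hnd ⟨hni, hW⟩
    rw [hind.eRk_eq_encard] at hlt
    exact lt_irrefl _ (lt_of_lt_of_le hlt le_self_add)
  obtain ⟨C, hCW, hC⟩ := hdep.exists_isCircuit_subset
  obtain ⟨x, hxC⟩ := hC.nonempty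
  have hxW : x ∈ W := hCW hxC
  -- deleting `x ∈ C` keeps the rank
  have hxcl : x ∈ M.closure (W \ {x}) :=
    M.closure_subset_closure (sdiff_subset_sdiff_left hCW) (hC.mem_closure_sdiff_singleton_of_mem hxC)
  have hrk : M.eRk (W \ {x}) = M.eRk W := by
    have h1 : M.closure (insert x (W \ {x})) = M.closure (W \ {x}) :=
      Matroid.closure_insert_eq_of_mem_closure hxcl
    rw [insert_sdiff_singleton, insert_eq_of_mem hxW] at h1
    rw [← M.eRk_closure_eq W, h1, M.eRk_closure_eq]
  have hcard : (W \ {x}).encard + 1 = W.encard := encard_sdiff_singleton_add_one hxW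
  have hk' : M.eRk (W \ {x}) + k ≤ (W \ {x}).encard := by
    rw [hrk]
    have h2 : M.eRk W + k + 1 ≤ (W \ {x}).encard + 1 := by
      rw [hcard]
      exact Order.add_one_le_of_lt hlt
    exact (WithTop.add_le_add_iff_right ENat.one_ne_top).1 h2
  have hncard : (W \ {x}).ncard < n := by
    rw [← hn]
    exact ncard_sdiff_singleton_lt_of_mem hxW hWfin
  obtain ⟨W', hW'sub, hW'⟩ := ih _ hncard (W \ {x}) (sdiff_subset.trans hW) rfl hk'
  exact ⟨W', hW'sub.trans sdiff_subset, hW'⟩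

end S2

namespace ThmN

open Set

variable {α : Type}

/-- **The concentrated half of the `(16, 7)` dichotomy, with `ν(W) ≥ k`**: the cell closes on every `e`-free coloop-free core
of rank `16` on `23` points carrying a set `W` with `(|W| ≤ 18 ∧ ν(W) ≥ 6) ∨ (|W| ≤ 14 ∧ ν(W) ≥ 5) ∨ (|W| ≤ 9 ∧ ν(W) ≥ 4)`
(nullity descent inside `W`, then `c025_sixteen_seven_of_concentrated`). -/
theorem c025_sixteen_seven_of_concentrated' (M : Matroid α) [M.Finite]
    (hR : M.eRank = ((16 : ℕ) : ℕ∞)) (hn : M.E.ncard = 16 + 7)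
    (hfree : ∀ e ∈ M.E, ∃ A ⊆ M.E \ {e}, e ∉ M.closure A ∧ e ∉ M.closure ((M.E \ {e}) \ A))
    (hK : ∀ e, ¬ M.IsColoop e)
    (hconc : ∃ W ⊆ M.E, (W.ncard ≤ 18 ∧ M.eRk W + 6 ≤ W.encard) ∨ (W.ncard ≤ 14 ∧ M.eRk W + 5 ≤ W.encard) ∨
      (W.ncard ≤ 9 ∧ M.eRk W + 4 ≤ W.encard)) : RLS M 16 5 := by
  obtain ⟨W, hW, h⟩ := hconc
  have hWfin : W.Finite := M.ground_finite.subset hW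
  rcases h with ⟨hWn, hk⟩ | ⟨hWn, hk⟩ | ⟨hWn, hk⟩
  · obtain ⟨W', hW'W, hW'⟩ := S2.exists_subset_encard_eq_eRk_add M hW 6 hk
    exact c025_sixteen_seven_of_nullity_six M hR hn hfree hK (hW'W.trans hW)
      ((ncard_le_ncard hW'W hWfin).trans hWn) hW'
  · obtain ⟨W', hW'W, hW'⟩ := S2.exists_subset_encard_eq_eRk_add M hW 5 hk
    exact c025_sixteen_seven_of_nullity_five M hR hn hfree hK (hW'W.trans hW)
      ((ncard_le_ncard hW'W hWfin).trans hWn) hW'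
  · obtain ⟨W', hW'W, hW'⟩ := S2.exists_subset_encard_eq_eRk_add M hW 4 hk
    exact c025_sixteen_seven_of_nullity_four M hR hn hfree hK (hW'W.trans hW)
      ((ncard_le_ncard hW'W hWfin).trans hWn) hW'

end ThmN

end PercRepro
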